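import Summits.ResolutionOfSingularities.ResolutionOfSingularities.Theorems.FrobeniusLadderFInjectiveMacaulayficationMonomialChartSections
import Summits.ResolutionOfSingularities.ResolutionOfSingularities.Theorems.FrobeniusLadderFInjectiveMacaulayficationMonomialChartPresentationPrime
import Summits.ResolutionOfSingularities.ResolutionOfSingularities.Theorems.FrobeniusLadderFInjectiveMacaulayficationPencilQuotFinSucc
import Literature.AlgebraicGeometry.Resolution.AffineBlowupIntegral
import HarnessLib

/-!
# BED Ω, GLOBAL PATCH (g-b), F4 (c) GLUE, THE PER-CHART PACKAGES: on a toric chart `U_c` of the class model `X̃ = Bl_{I_A} X` (`X = V(f)` a prime hypersurface) where the second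
# centre `(I_A + (g₀))·𝒪_{X̃}` reads `y^G·(y^{M₁}, χ)` in `k[y]/(θ_c)`, the blowing up `S′ → X̃` along it has COHEN–MACAULAY STALKS over `U_c` — (P) the PENCIL package when `(θ_c, χ)` is a
# prime ideal missing `y^{M₁}`, (Q) the PRINCIPAL package when `y^{M₁}` is a unit modulo `θ_c`
# (crux `FInjectiveMacaulayfication` stmt-ResolutionOfSingularities-15315, chain w45a; res-L1-w45a-plan-1 BOOKED 2026-08-29T08:08:13Z «F4(c) GLUE»; seat res-L1-w45a-stub-3 g14)

[OURS · L1 W4.5a] Support file (`--supports stmt-ResolutionOfSingularities-15315 --as helper`); theorems only; GENERIC over the monomial-chart binder block (any `n`, any prime hypersurface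
`f`, any unimodular chart `(V, m, a)`, any second generator `g₀`); no named fact; NOT a statement of any manuscript; nothing of the crux is proved. AI-written (AI review is weaker than expert
review). Assembles ✓p709719 `PencilBlowupLocalCharts` (scheme glue), ✓p710390 `MonomialChartSections` (`Γ(X̃, U_c) ≅ k[y]/(θ_c)`), ✓ `PencilQuotFinSucc` (the pencil rings are
codimension-2 complete intersections, CM at every prime) and ✓ `MonomialChartPresentationPrime` (prime hypersurface: no `hunit`).

* §1 `exists_sections_ringEquiv_of_isPrime` — the section-ring isomorphism of ✓ `MonomialChartSections` under `(f)` prime / `x̄_j ≠ 0` instead of `hunit`;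
  `map_theta_span_monomials` — on the chart, `θ_V(I_A)·k[y]/(θ) = (ȳ^{V m})` (chart inequalities `hge`, `m ∈ A`); `ideal_chart_eq` — the second centre's chart ideal is
  `Φ⁻¹(ȳ^G ȳ^{M₁}, ȳ^G χ̄)` once `θ_V g₀ = y^G χ` and `V m = G + M₁`.
* §2 ★★ `cmCl_stalk_over_pencilChart` — (P): `θ` prime, no variable divides `θ`, `θ ∤ χ`, `(θ, χ)` prime, `y^{M₁} ∉ (θ, χ)` ⇒ `CMCl 𝒪_{S′,s}` for every `s` over `U_c`.
* §3 ★★ `cmCl_stalk_over_principalChart` — (Q): `ȳ^{M₁}` a unit of `k[y]/(θ)`, `θ ∤ y^G` ⇒ the centre is `(ȳ^G)` on `U_c` (regular because `X̃` is integral, ✓ `affineBlowup.isIntegral`),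
  `S′ → X̃` is an isomorphism over `U_c`, and `CMCl` passes from `𝒪_{X̃, τ s}`.
[cite: StacksProject, Tag 0804, Tag 0BIQ, Tag 080A; CoxLittleSchenck2011, §2.3; Matsumura1987, Thm. 17.4]
-/

set_option linter.dupNamespace false

noncomputable section

open AlgebraicGeometry CategoryTheory Literature.AlgebraicGeometry.Resolution MvPolynomial

namespace Summit.ResolutionOfSingularities.ResolutionOfSingularities.Theorems.FInjectiveMacaulayfication.PencilChartPackage

open Summit.ResolutionOfSingularities.ResolutionOfSingularities.Theorems.FInjectiveMacaulayfication
open SliceableCentre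

variable {n : ℕ} {k : Type} [Field k]

section Chart

variable (f : MvPolynomial (Fin n) k) (V : Matrix (Fin n) (Fin n) ℕ) (hV : IsUnit (V.map (Nat.cast : ℕ → ℤ)).det)
  (m : Fin n →₀ ℕ) (a : Fin n → (Fin n →₀ ℕ))
  (hgen : ∀ i : Fin n, (Finsupp.equivFunOnFinite.symm (V.mulVec ⇑(a i)) : Fin n →₀ ℕ) =
    Finsupp.equivFunOnFinite.symm (V.mulVec ⇑m) + Finsupp.single i 1)
  (A : Finset (Fin n →₀ ℕ)) (haA : ∀ i, a i ∈ A) (hmA : m ∈ A)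
  (hge : ∀ e ∈ A, (Finsupp.equivFunOnFinite.symm (V.mulVec ⇑m) : Fin n →₀ ℕ) ≤
    Finsupp.equivFunOnFinite.symm (V.mulVec ⇑e))
  (d : Fin n →₀ ℕ) (θ : MvPolynomial (Fin n) k)
  (hθ : aeval (fun j : Fin n => ∏ i : Fin n, (X i : MvPolynomial (Fin n) k) ^ V i j) f = monomial d (1 : k) * θ)
  (hprime : (Ideal.span {f}).IsPrime) (hXne : ∀ j : Fin n, Ideal.Quotient.mk (Ideal.span {f}) (X j) ≠ 0)
  (hcop : ∀ i : Fin n, ¬ (X i ∣ θ))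
  (hm : Ideal.Quotient.mk (Ideal.span {f}) (monomial m (1 : k)) ∈
    Ideal.span ((fun e : Fin n →₀ ℕ => Ideal.Quotient.mk (Ideal.span {f}) (monomial e (1 : k))) '' (A : Set (Fin n →₀ ℕ))))
  (g₀ : MvPolynomial (Fin n) k) (G M₁ : Fin n →₀ ℕ) (χ : MvPolynomial (Fin n) k)
  (hg₀ : aeval (fun j : Fin n => ∏ i : Fin n, (X i : MvPolynomial (Fin n) k) ^ V i j) g₀ = monomial G (1 : k) * χ)
  (hC : (Finsupp.equivFunOnFinite.symm (V.mulVec ⇑m) : Fin n →₀ ℕ) = G + M₁)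

/-! ## §1 The section ring and the chart ideal of the second centre -/

section Sections
include hV hgen haA hge hθ hprime hXne hcop

/-- The section-ring isomorphism `Φ : Γ(Bl_{I_A} X, D₊(x^m t)) ≅ k[y]/(θ)` with `Φ(π^* q̄) = (θ_V q)‾`, for a PRIME hypersurface with no `x̄_j = 0` (✓ `MonomialChartSections.exists_sections_ringEquiv_of_ringEquiv`
with ✓ `MonomialChartPresentationPrime.exists_monomialChartPresentation_of_isPrime`). [OURS · F4 (c) glue; cite: StacksProject, Tag 0804; CoxLittleSchenck2011, §2.3] -/
theorem exists_sections_ringEquiv_of_isPrime :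
    ∃ Φ : Γ(affineBlowup (Ideal.span ((fun e : Fin n →₀ ℕ => Ideal.Quotient.mk (Ideal.span {f}) (monomial e (1 : k))) '' (A : Set (Fin n →₀ ℕ)))),
        affineBlowup.chartOpen (Ideal.Quotient.mk (Ideal.span {f}) (monomial m (1 : k))) hm) ≃+* (MvPolynomial (Fin n) k ⧸ Ideal.span {θ}),
      ∀ q : MvPolynomial (Fin n) k,
        Φ (affineBlowup.pull (Ideal.span ((fun e : Fin n →₀ ℕ => Ideal.Quotient.mk (Ideal.span {f}) (monomial e (1 : k))) '' (A : Set (Fin n →₀ ℕ))))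
            (affineBlowup.chartOpen (Ideal.Quotient.mk (Ideal.span {f}) (monomial m (1 : k))) hm) (Ideal.Quotient.mk (Ideal.span {f}) q)) =
          Ideal.Quotient.mk (Ideal.span {θ}) (aeval (fun j : Fin n => ∏ i : Fin n, (X i : MvPolynomial (Fin n) k) ^ V i j) q) := by
  obtain ⟨eP, hbij, hθq⟩ := MonomialChartPresentationPrime.exists_monomialChartPresentation_of_isPrime f V hV m a hgen A haA hge d θ hθ hprime hXne hcop
  obtain ⟨Φ, hΦ⟩ := MonomialChartSections.exists_sections_ringEquiv_of_ringEquiv _ _ hm (RingEquiv.ofBijective eP hbij).symm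
  refine ⟨Φ, fun q => ?_⟩
  have h4 : eP (Ideal.Quotient.mk (Ideal.span {θ}) (aeval (fun j : Fin n => ∏ i : Fin n, (X i : MvPolynomial (Fin n) k) ^ V i j) q)) =
      algebraMap _ _ (Ideal.Quotient.mk (Ideal.span {f}) q) := by
    apply Subtype.ext
    rw [hθq q, Subalgebra.coe_algebraMap]
  rw [hΦ, ← h4]
  exact (RingEquiv.ofBijective eP hbij).symm_apply_apply _

end Sections

section Ideal
include hge hmA

/-- On the chart, the monomial centre becomes principal: `(θ_V x^e : e ∈ A)‾ = (ȳ^{V m})` in `k[y]/(θ)` (each `y^{Ve}` is a multiple of `y^{Vm}` by `hge`; `m ∈ A`). [folklore; cite: CoxLittleSchenck2011, §2.3] -/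
theorem map_theta_span_monomials :
    ((Ideal.span ((fun e : Fin n →₀ ℕ => (monomial e (1 : k) : MvPolynomial (Fin n) k)) '' (A : Set (Fin n →₀ ℕ)))).map
        (aeval (fun j : Fin n => ∏ i : Fin n, (X i : MvPolynomial (Fin n) k) ^ V i j)).toRingHom).map (Ideal.Quotient.mk (Ideal.span {θ})) =
      Ideal.span {Ideal.Quotient.mk (Ideal.span {θ}) (monomial (Finsupp.equivFunOnFinite.symm (V.mulVec ⇑m)) (1 : k))} := by
  rw [Ideal.map_map, Ideal.map_span]
  apply le_antisymm
  · rw [Ideal.span_le]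
    rintro _ ⟨_, ⟨e, he, rfl⟩, rfl⟩
    rw [SetLike.mem_coe, Ideal.mem_span_singleton, RingHom.comp_apply, AlgHom.toRingHom_eq_coe, AlgHom.coe_toRingHom, ToricChartFedder.theta_monomial]
    refine ⟨Ideal.Quotient.mk (Ideal.span {θ}) (monomial (Finsupp.equivFunOnFinite.symm (V.mulVec ⇑e) - Finsupp.equivFunOnFinite.symm (V.mulVec ⇑m)) 1), ?_⟩
    rw [← map_mul, monomial_mul, one_mul, add_tsub_cancel_of_le (hge e (Finset.mem_coe.mp he))]
  · rw [Ideal.span_le, Set.singleton_subset_iff, SetLike.mem_coe]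
    refine Ideal.subset_span ⟨monomial m 1, ⟨m, Finset.mem_coe.mpr hmA, rfl⟩, ?_⟩
    rw [RingHom.comp_apply, AlgHom.toRingHom_eq_coe, AlgHom.coe_toRingHom, ToricChartFedder.theta_monomial]

omit hmA hge in
/-- The second centre of F4 (a), `I_A·R + (ḡ₀)`, is the image of `(x^e : e ∈ A) + (g₀) ⊆ k[x]`. [bookkeeping] -/
theorem centre_eq_map :
    Ideal.span ((fun e : Fin n →₀ ℕ => Ideal.Quotient.mk (Ideal.span {f}) (monomial e (1 : k))) '' (A : Set (Fin n →₀ ℕ))) +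
        Ideal.span {Ideal.Quotient.mk (Ideal.span {f}) g₀} =
      (Ideal.span ((fun e : Fin n →₀ ℕ => (monomial e (1 : k) : MvPolynomial (Fin n) k)) '' (A : Set (Fin n →₀ ℕ))) ⊔ Ideal.span {g₀}).map
        (Ideal.Quotient.mk (Ideal.span {f})) := by
  rw [Ideal.map_sup, Ideal.map_span, Ideal.map_span, Set.image_image, Set.image_singleton]
  rfl

include hg₀ hC in
/-- In `k[y]/(θ)`: the image of `(x^e : e ∈ A) + (g₀)` under the chart substitution is `(ȳ^G·ȳ^{M₁}, ȳ^G·χ̄)`. [bookkeeping] -/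
theorem map_centre_eq :
    ((Ideal.span ((fun e : Fin n →₀ ℕ => (monomial e (1 : k) : MvPolynomial (Fin n) k)) '' (A : Set (Fin n →₀ ℕ))) ⊔ Ideal.span {g₀}).map
        (aeval (fun j : Fin n => ∏ i : Fin n, (X i : MvPolynomial (Fin n) k) ^ V i j)).toRingHom).map (Ideal.Quotient.mk (Ideal.span {θ})) =
      Ideal.span {Ideal.Quotient.mk (Ideal.span {θ}) (monomial G 1) * Ideal.Quotient.mk (Ideal.span {θ}) (monomial M₁ 1),
        Ideal.Quotient.mk (Ideal.span {θ}) (monomial G 1) * Ideal.Quotient.mk (Ideal.span {θ}) χ} := by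
  have hg₀' : (aeval (fun j : Fin n => ∏ i : Fin n, (X i : MvPolynomial (Fin n) k) ^ V i j)).toRingHom g₀ = monomial G (1 : k) * χ := hg₀
  have hGM : (monomial (G + M₁) (1 : k) : MvPolynomial (Fin n) k) = monomial G 1 * monomial M₁ 1 := by rw [monomial_mul, one_mul]
  rw [Ideal.map_sup, Ideal.map_sup, map_theta_span_monomials V m A hmA hge θ, Ideal.map_span _ {g₀}, Set.image_singleton, Ideal.map_span, Set.image_singleton, hg₀', hC,
    hGM, map_mul, map_mul, Ideal.span_insert]

include hg₀ hC in
set_option maxHeartbeats 800000 in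
-- the chart-formula rewrite elaborates the full centre twice
/-- ★ **THE CHART IDEAL OF THE SECOND CENTRE**: on `D₊(x^m t)`, `(I_A + (g₀))~·𝒪_{X̃}` has the ideal `Φ⁻¹(ȳ^G·ȳ^{M₁}, ȳ^G·χ̄)`. [OURS · F4 (c) glue; cite: GortzWedhorn2020, (13.19)] -/
theorem ideal_chart_eq
    (Φ : Γ(affineBlowup (Ideal.span ((fun e : Fin n →₀ ℕ => Ideal.Quotient.mk (Ideal.span {f}) (monomial e (1 : k))) '' (A : Set (Fin n →₀ ℕ)))),
        affineBlowup.chartOpen (Ideal.Quotient.mk (Ideal.span {f}) (monomial m (1 : k))) hm) ≃+* (MvPolynomial (Fin n) k ⧸ Ideal.span {θ}))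
    (hΦ : ∀ q : MvPolynomial (Fin n) k,
        Φ (affineBlowup.pull (Ideal.span ((fun e : Fin n →₀ ℕ => Ideal.Quotient.mk (Ideal.span {f}) (monomial e (1 : k))) '' (A : Set (Fin n →₀ ℕ))))
            (affineBlowup.chartOpen (Ideal.Quotient.mk (Ideal.span {f}) (monomial m (1 : k))) hm) (Ideal.Quotient.mk (Ideal.span {f}) q)) =
          Ideal.Quotient.mk (Ideal.span {θ}) (aeval (fun j : Fin n => ∏ i : Fin n, (X i : MvPolynomial (Fin n) k) ^ V i j) q)) :
    ((affineBlowup.idealSheaf (Ideal.span ((fun e : Fin n →₀ ℕ => Ideal.Quotient.mk (Ideal.span {f}) (monomial e (1 : k))) '' (A : Set (Fin n →₀ ℕ))) +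
        Ideal.span {Ideal.Quotient.mk (Ideal.span {f}) g₀})).comap
        (affineBlowup.π (Ideal.span ((fun e : Fin n →₀ ℕ => Ideal.Quotient.mk (Ideal.span {f}) (monomial e (1 : k))) '' (A : Set (Fin n →₀ ℕ)))))).ideal
        (affineBlowup.chartOpen (Ideal.Quotient.mk (Ideal.span {f}) (monomial m (1 : k))) hm) =
      Ideal.span {Φ.symm (Ideal.Quotient.mk (Ideal.span {θ}) (monomial G 1)) * Φ.symm (Ideal.Quotient.mk (Ideal.span {θ}) (monomial M₁ 1)),
        Φ.symm (Ideal.Quotient.mk (Ideal.span {θ}) (monomial G 1)) * Φ.symm (Ideal.Quotient.mk (Ideal.span {θ}) χ)} := by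
  have e1 : Φ.symm (Ideal.Quotient.mk (Ideal.span {θ}) (monomial G 1) * Ideal.Quotient.mk (Ideal.span {θ}) (monomial M₁ 1)) =
      Φ.symm (Ideal.Quotient.mk (Ideal.span {θ}) (monomial G 1)) * Φ.symm (Ideal.Quotient.mk (Ideal.span {θ}) (monomial M₁ 1)) := map_mul _ _ _
  have e2 : Φ.symm (Ideal.Quotient.mk (Ideal.span {θ}) (monomial G 1) * Ideal.Quotient.mk (Ideal.span {θ}) χ) =
      Φ.symm (Ideal.Quotient.mk (Ideal.span {θ}) (monomial G 1)) * Φ.symm (Ideal.Quotient.mk (Ideal.span {θ}) χ) := map_mul _ _ _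
  rw [centre_eq_map, MonomialChartSections.ideal_comap_chartOpen_eq_comap f V m A θ hm Φ hΦ, map_centre_eq V m A hmA hge θ g₀ G M₁ χ hg₀ hC, RingEquiv.toRingHom_eq_coe, Ideal.comap_coe,
    ← Ideal.map_symm, Ideal.map_span, Set.image_pair, ← e1, ← e2]

end Ideal

/-! ## §2 (P) The pencil package -/

include hV hgen haA hmA hge hθ hprime hXne hcop hg₀ hC in
set_option maxHeartbeats 800000 in
-- large binder block; the glue lemma is instantiated at the explicit centre
/-- ★★ **(P) CM STALKS OVER A PENCIL CHART.** Let `τ : S′ → X̃ = Bl_{I_A} X` be a blowing up along `(I_A + (g₀))~·𝒪_{X̃}` (`X = V(f)` prime, no `x̄_j = 0`). On the vertex chart `D₊(x^m t)`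
with `θ_V f = y^d θ` (`θ` prime, divisible by no variable), `θ_V g₀ = y^G χ`, `V m = G + M₁`: if `θ ∤ χ`, `(θ, χ)` is a prime ideal and `y^{M₁} ∉ (θ, χ)`, then `𝒪_{S′,s}` satisfies the CM
clause for every `s` over the chart. [OURS · F4 (c) glue; cite: StacksProject, Tag 0804, Tag 0BIQ; Matsumura1987, Thm. 17.4] -/
theorem cmCl_stalk_over_pencilChart (hθp : Prime θ) (hθχ : ¬ θ ∣ χ) (hpair : (Ideal.span {θ, χ}).IsPrime) (hM₁ : (monomial M₁ (1 : k) : MvPolynomial (Fin n) k) ∉ Ideal.span {θ, χ})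
    {S' : Scheme.{0}} {τ : S' ⟶ affineBlowup (Ideal.span ((fun e : Fin n →₀ ℕ => Ideal.Quotient.mk (Ideal.span {f}) (monomial e (1 : k))) '' (A : Set (Fin n →₀ ℕ))))}
    (hτ : IsBlowup τ ((affineBlowup.idealSheaf (Ideal.span ((fun e : Fin n →₀ ℕ => Ideal.Quotient.mk (Ideal.span {f}) (monomial e (1 : k))) '' (A : Set (Fin n →₀ ℕ))) +
        Ideal.span {Ideal.Quotient.mk (Ideal.span {f}) g₀})).comap
        (affineBlowup.π (Ideal.span ((fun e : Fin n →₀ ℕ => Ideal.Quotient.mk (Ideal.span {f}) (monomial e (1 : k))) '' (A : Set (Fin n →₀ ℕ)))))))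
    (s : S') (hs : τ.base s ∈ (affineBlowup.chartOpen (Ideal.Quotient.mk (Ideal.span {f}) (monomial m (1 : k))) hm :
      (affineBlowup (Ideal.span ((fun e : Fin n →₀ ℕ => Ideal.Quotient.mk (Ideal.span {f}) (monomial e (1 : k))) '' (A : Set (Fin n →₀ ℕ))))).Opens)) :
    CMCl (S'.presheaf.stalk s) := by
  obtain ⟨Φ, hΦ⟩ := exists_sections_ringEquiv_of_isPrime f V hV m a hgen A haA hge d θ hθ hprime hXne hcop hm
  have h𝒥 := ideal_chart_eq f V m A hmA hge θ hm g₀ G M₁ χ hg₀ hC Φ hΦ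
  -- the data in `k[y]/(θ)`
  haveI : (Ideal.span {θ}).IsPrime := (Ideal.span_singleton_prime hθp.ne_zero).mpr hθp
  haveI : IsDomain (MvPolynomial (Fin n) k ⧸ Ideal.span {θ}) := Ideal.Quotient.isDomain _
  have hGnzd := PencilQuotFinSucc.mk_mem_nonZeroDivisors hθp (PencilQuotFinSucc.not_dvd_monomial_of_forall_not_X_dvd hθp hcop G)
  have hM₁ndvd := PencilQuotFinSucc.not_dvd_monomial_of_forall_not_X_dvd hθp hcop M₁
  have hUnzd := PencilQuotFinSucc.mk_mem_nonZeroDivisors hθp hM₁ndvd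
  have hVnzd := PencilQuotFinSucc.mk_mem_nonZeroDivisors hθp hθχ
  have hVU : ∀ r : MvPolynomial (Fin n) k ⧸ Ideal.span {θ}, Ideal.Quotient.mk (Ideal.span {θ}) χ ∣ r * Ideal.Quotient.mk (Ideal.span {θ}) (monomial M₁ 1) →
      Ideal.Quotient.mk (Ideal.span {θ}) χ ∣ r := PencilQuotFinSucc.regularPair_of_isPrime hpair hM₁
  have hUV : ∀ r : MvPolynomial (Fin n) k ⧸ Ideal.span {θ}, Ideal.Quotient.mk (Ideal.span {θ}) (monomial M₁ 1) ∣ r * Ideal.Quotient.mk (Ideal.span {θ}) χ →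
      Ideal.Quotient.mk (Ideal.span {θ}) (monomial M₁ 1) ∣ r := PencilQuotFinSucc.regularPair_symm (nonZeroDivisors.ne_zero hVnzd) hVU
  -- transport along `Φ.symm`
  obtain ⟨hu, huv⟩ := PencilBlowupLocalCharts.regularPair_of_ringEquiv Φ.symm hUnzd hUV
  obtain ⟨hv, hvu⟩ := PencilBlowupLocalCharts.regularPair_of_ringEquiv Φ.symm hVnzd hVU
  have hγ : Φ.symm (Ideal.Quotient.mk (Ideal.span {θ}) (monomial G 1)) ∈ nonZeroDivisors _ :=
    (PencilBlowupLocalCharts.regularPair_of_ringEquiv Φ.symm hGnzd (v := 1) (fun r h => by simpa using h)).1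
  refine PencilBlowupLocalCharts.cmCl_stalk_of_pair hτ _ _ _ _ h𝒥 hγ hu huv hv hvu ?_ ?_ s hs
  · intro Q _
    exact PencilQuotFinSucc.cmCl_localization_pencilQuot k θ Φ _ _ (monomial M₁ 1) χ (Φ.apply_symm_apply _) (Φ.apply_symm_apply _) hθp hM₁ndvd Q
  · intro Q _
    exact PencilQuotFinSucc.cmCl_localization_pencilQuot k θ Φ _ _ χ (monomial M₁ 1) (Φ.apply_symm_apply _) (Φ.apply_symm_apply _) hθp hθχ Q

/-! ## §3 (Q) The principal package -/

include hV hgen haA hmA hge hθ hprime hXne hcop hg₀ hC in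
set_option maxHeartbeats 800000 in
-- large binder block; the glue lemma is instantiated at the explicit centre
/-- ★★ **(Q) CM STALKS OVER A PRINCIPAL CHART.** In the setting of §2, if instead `ȳ^{M₁}` is a UNIT of `k[y]/(θ)` and `θ ∤ y^G`, then the second centre is `(ȳ^G)` on the chart (a nonzero, hence
regular, section of the INTEGRAL scheme `X̃`), `τ` is an isomorphism over the chart, and the CM clause passes from `𝒪_{X̃, τ s}` to `𝒪_{S′, s}`. [OURS · F4 (c) glue; cite: StacksProject, Tag 02OS] -/
theorem cmCl_stalk_over_principalChart (hGθ : ¬ θ ∣ monomial G (1 : k)) (hunitM : IsUnit (Ideal.Quotient.mk (Ideal.span {θ}) (monomial M₁ (1 : k))))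
    {S' : Scheme.{0}} {τ : S' ⟶ affineBlowup (Ideal.span ((fun e : Fin n →₀ ℕ => Ideal.Quotient.mk (Ideal.span {f}) (monomial e (1 : k))) '' (A : Set (Fin n →₀ ℕ))))}
    (hτ : IsBlowup τ ((affineBlowup.idealSheaf (Ideal.span ((fun e : Fin n →₀ ℕ => Ideal.Quotient.mk (Ideal.span {f}) (monomial e (1 : k))) '' (A : Set (Fin n →₀ ℕ))) +
        Ideal.span {Ideal.Quotient.mk (Ideal.span {f}) g₀})).comap
        (affineBlowup.π (Ideal.span ((fun e : Fin n →₀ ℕ => Ideal.Quotient.mk (Ideal.span {f}) (monomial e (1 : k))) '' (A : Set (Fin n →₀ ℕ)))))))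
    (s : S') (hs : τ.base s ∈ (affineBlowup.chartOpen (Ideal.Quotient.mk (Ideal.span {f}) (monomial m (1 : k))) hm :
      (affineBlowup (Ideal.span ((fun e : Fin n →₀ ℕ => Ideal.Quotient.mk (Ideal.span {f}) (monomial e (1 : k))) '' (A : Set (Fin n →₀ ℕ))))).Opens))
    (hX : CMCl ((affineBlowup (Ideal.span ((fun e : Fin n →₀ ℕ => Ideal.Quotient.mk (Ideal.span {f}) (monomial e (1 : k))) '' (A : Set (Fin n →₀ ℕ))))).presheaf.stalk (τ.base s))) :
    CMCl (S'.presheaf.stalk s) := by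
  obtain ⟨Φ, hΦ⟩ := exists_sections_ringEquiv_of_isPrime f V hV m a hgen A haA hge d θ hθ hprime hXne hcop hm
  have h𝒥 := ideal_chart_eq f V m A hmA hge θ hm g₀ G M₁ χ hg₀ hC Φ hΦ
  -- `X̃` is integral, so `Γ(X̃, D₊(x^m t))` is a domain and the nonzero section `γ = Φ⁻¹(ȳ^G)` is regular
  haveI := hprime
  haveI : IsDomain (MvPolynomial (Fin n) k ⧸ Ideal.span {f}) := Ideal.Quotient.isDomain _
  have hm0 : Ideal.Quotient.mk (Ideal.span {f}) (monomial m (1 : k)) ≠ 0 := by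
    classical
    rw [monomial_eq, C_1, one_mul, Finsupp.prod, map_prod]
    exact Finset.prod_ne_zero_iff.mpr fun j _ => by rw [map_pow]; exact pow_ne_zero _ (hXne j)
  haveI : IsIntegral (affineBlowup (Ideal.span ((fun e : Fin n →₀ ℕ => Ideal.Quotient.mk (Ideal.span {f}) (monomial e (1 : k))) '' (A : Set (Fin n →₀ ℕ))))) :=
    affineBlowup.isIntegral fun h0 => hm0 (by rw [← Ideal.mem_bot, ← h0]; exact hm)
  have hγ0 : Φ.symm (Ideal.Quotient.mk (Ideal.span {θ}) (monomial G 1)) ≠ 0 := by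
    intro h0
    have h1 : Ideal.Quotient.mk (Ideal.span {θ}) (monomial G (1 : k)) = 0 := by rw [← Φ.apply_symm_apply (Ideal.Quotient.mk _ _), h0, map_zero]
    rw [Ideal.Quotient.eq_zero_iff_mem, Ideal.mem_span_singleton] at h1
    exact hGθ h1
  haveI : IsDomain Γ(affineBlowup (Ideal.span ((fun e : Fin n →₀ ℕ => Ideal.Quotient.mk (Ideal.span {f}) (monomial e (1 : k))) '' (A : Set (Fin n →₀ ℕ)))),
      (affineBlowup.chartOpen (Ideal.Quotient.mk (Ideal.span {f}) (monomial m (1 : k))) hm :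
        (affineBlowup (Ideal.span ((fun e : Fin n →₀ ℕ => Ideal.Quotient.mk (Ideal.span {f}) (monomial e (1 : k))) '' (A : Set (Fin n →₀ ℕ))))).Opens)) :=
    @IsIntegral.component_integral _ inferInstance _ ⟨⟨τ.base s, hs⟩⟩
  have hγ : Φ.symm (Ideal.Quotient.mk (Ideal.span {θ}) (monomial G 1)) ∈ nonZeroDivisors _ := mem_nonZeroDivisors_of_ne_zero hγ0
  -- the centre is principal: `(γu, γv) = (γ)` since `u` is a unit and `γv ∈ (γ)`
  have hunit' : IsUnit (Φ.symm (Ideal.Quotient.mk (Ideal.span {θ}) (monomial M₁ (1 : k)))) := hunitM.map Φ.symm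
  have h𝒥' : ((affineBlowup.idealSheaf (Ideal.span ((fun e : Fin n →₀ ℕ => Ideal.Quotient.mk (Ideal.span {f}) (monomial e (1 : k))) '' (A : Set (Fin n →₀ ℕ))) +
        Ideal.span {Ideal.Quotient.mk (Ideal.span {f}) g₀})).comap
        (affineBlowup.π (Ideal.span ((fun e : Fin n →₀ ℕ => Ideal.Quotient.mk (Ideal.span {f}) (monomial e (1 : k))) '' (A : Set (Fin n →₀ ℕ)))))).ideal
        (affineBlowup.chartOpen (Ideal.Quotient.mk (Ideal.span {f}) (monomial m (1 : k))) hm) =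
      Ideal.span {Φ.symm (Ideal.Quotient.mk (Ideal.span {θ}) (monomial G 1))} := by
    rw [h𝒥, Ideal.span_insert, Ideal.span_singleton_mul_right_unit hunit', sup_eq_left]
    exact Ideal.span_singleton_le_span_singleton.mpr (dvd_mul_right _ _)
  exact PencilBlowupLocalCharts.cmCl_stalk_of_principal hτ _ _ h𝒥' hγ s hs hX

end Chart

end Summit.ResolutionOfSingularities.ResolutionOfSingularities.Theorems.FInjectiveMacaulayfication.PencilChartPackage

end
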